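import Literature.RepresentationTheory.KonnoKonno2007.FockModelUnitaryDualPair
import HarnessLib

/-!
# Konno–Konno 2007, Lemma 5.2 — the vacuum-character record in PRINTED-CLAUSES-ONLY form

Source: T. Konno, K. Konno, *On doubling construction for real unitary dual pairs*, Kyushu J.
Math. **61** (2007) 35–82, doi:10.2206/kyushujm.61.35 — bib key `KonnoKonno2007`; held as
[corpus: paper:doi-10-2206-kyushujm-61-35] (materialised `pNNNN.txt`, journal page = PDF page + 34;
the verbatim pack, the extraction caveats K-1/K-2 and the object-match duties §4 (a)–(f) are those of
the module docstring of `Literature.RepresentationTheory.KonnoKonno2007.FockModelUnitaryDualPair`,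
which this file imports and does not repeat).

## What this file adds, and why

The landed record `RealDualPairJunction.FockVacuumCharacter D e` says: over the junction datum `D`
there is `ω` which is an archimedean Weil datum over `D.ι𝕎` (tree notion
`Literature.NumberTheory.Weil1964.IsArchWeilDatum` = (w1) strong continuity of the orbit maps into
`𝓢`, (w2) Heisenberg covariance over `ι𝕎`, (w2′) unitary lifts to `L²`) and whose vacuum `hermitePi 0`
is a `K_V × K_W`-eigenvector with the determinant-power eigencharacter `vacScalar e`.

Of these clauses, (w2), (w2′) and the vacuum values have verbatim print loci — §2.1 p. 38 L5–11
(p0004): "*`Sp(W)` acts on `H(W)` by `(w; z).g = (w.g; z)`. According to the Stone–von Neumann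
theorem, there exists a unique isomorphism class `ρ_ψ^W = ρ_ψ` of irreducible unitary representation
of `H(W)` on which the centre `{(0; z) | z ∈ ℝ}` acts by `ψ`. Then this uniquely extends to an
irreducible unitary representation `ρ_ψ` of the metaplectic Jacobi group `J(W) := H(W) ⋊ Mp(W)`.
Here, `Mp(W)` acts on `H(W)` by the `Sp(W)`-action on `W`. The restriction `ω_{W,ψ} = ω_W` of `ρ_ψ`
to `Mp(W)` is the Weil representation of `Mp(W)`.*" (covariance (w2) and unitarity (w2′) of `ω_W`);
p. 38 L38–39: "*Then `ω_W` is realized on `L²(Y′) = L²(ℝ^N)` and is characterized by the following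
formulae: (2.1)*" ((w2′): the operators live on `L²`); §3.3 p. 47 L83–86 (p0013): "*Composing the
above homomorphisms with the Weil representation `ω_W` of `Mp(W)`, we obtain the Weil representation
`ω_{V,W,ξ} = ω_{W,ξ} × ω_{V,ξ′}` of `G_V × G_W`: `ω_{W,ξ} := ω_W ∘ ι̃_{W,ξ}`, `ω_{V,ξ′} := ω_W ∘
ι̃_{V,ξ′}`*" (so `ω_{V,W,ξ}` inherits (w2) over `ι_{V,W}` and (w2′)); Lemma 5.2 p. 73 L44–102 (p0039)
(the vacuum values; quoted in the record's docstring below) — whereas (w1), continuity on the Fréchet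
space `𝓢`, is the one clause the paper does not print as such (p. 39 L23–24 (p0005) says only "*The
restriction of `ρ_ψ` to the subspace `S(Y′) ⊂ L²(Y′)` of Schwartz–Bruhat functions is a smooth
representation of `J(W)`*").  In the tree, (w1) is now DERIVED from (w2) + (w2′) + the vacuum values
by the `KAK` descent (`Literature.NumberTheory.Weil1964.ArchWeilContinuityKAK`:
`isArchWeilDatum_of_kak`, `isArchWeilDatum_of_vacuum`; at the concrete junction `U(p,q) × U(r,s)`:
`Literature.RepresentationTheory.KonnoKonno2007.JunctionContinuityKAK`,
`isArchWeilDatum_junction_of_vacScalar` / `…_of_compact_of_vacScalar`).  Cell booking (MODEL-DAG carver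
model1-g4, STATUS 2026-08-19T00:29:27Z): "the `continuous_apply` clause of N-W∞-c `FockVacuumCharacter`
is DERIVED (K), not cited; the P content of row N-W∞-c stays the KK07 Lemma 5.2 character VALUES".

Accordingly this file states the SAME fact with the `IsArchWeilDatum` clause replaced by its two printed
fields — `RealDualPairJunction.FockVacuumCharacterPrinted D e` := there is `ω` over `D.ι𝕎`,
Heisenberg-covariant ((w2)), by restrictions of unitaries of `L²` ((w2′)), with
`ω (D.κ k) (hermitePi 0) = vacScalar e k • hermitePi 0` for all `k ∈ K_V × K_W` — and proves in the
kernel: the landed record implies the printed one (`FockVacuumCharacter.printed`); the converse given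
ANY upgrade map producing (w1) from the printed clauses
(`FockVacuumCharacterPrinted.fockVacuumCharacter_of_upgrade`, `…_of_continuous_upgrade`; the `iff`
under such a map) — at a concrete junction the upgrade slot is
filled BY NAME by the `JunctionContinuityKAK` theorems above, so no consumer loses anything; and the
value transfer to any other covariant-with-lifts realisation over the same `D.ι𝕎` (the cell's own
`ω_∞`): its vacuum scalars on `K_V × K_W` are `vacScalar e` times a unitary character of `G_V × G_W`
(`FockVacuumCharacterPrinted.exists_circle_twist`, from the tree's rigidity
`IsArchWeilDatum.exists_character`, which consumes only (w2) + (w2′) of the printed `ω`).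

The exponent tuple `e` remains a PARAMETER (K-1/K-2 discipline of the imported file, its §3); the record
COUNTS once, at the place where either form is assumed about constructed objects (cell MODEL-N row
N-W∞-c; this re-typing changes no count).  Nothing about any concrete group is asserted here.
-/

set_option autoImplicit false

noncomputable section

open MeasureTheory Complex SchwartzMap Matrix

namespace Literature.RepresentationTheory.KonnoKonno2007

open Literature.Analysis.SegalBargmann Literature.RepresentationTheory.HeisenbergGroup
open Literature.NumberTheory.Weil1964

variable {P Q R S : Type*} [Fintype P] [DecidableEq P] [Fintype Q] [DecidableEq Q] [Fintype R]
  [DecidableEq R] [Fintype S] [DecidableEq S]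
variable {Ginf : Type*} [Group Ginf] [TopologicalSpace Ginf]

namespace RealDualPairJunction

/-! ## 1. The record, printed clauses only -/

/-- **[KonnoKonno2007, Lemma 5.2 (i)/(ii) p. 73 (with §2.1 p. 38, §3.3 p. 47, §4.1 p. 49, §5.2 p. 72;
cf. Thm 5.4 (i) (5.6)/(5.7) p. 75)] —
the Weil representation of the real unitary dual pair attached to the character pair `ξ` exists over
`ι_{V,W}` as a Heisenberg-covariant representation by (restrictions of) unitary operators, and its
vacuum line is a `K_V × K_W`-eigenline with a determinant-power eigencharacter.**
Verbatim (p. 38): "*this uniquely extends to an irreducible unitary representation `ρ_ψ` of the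
metaplectic Jacobi group `J(W) := H(W) ⋊ Mp(W)`. Here, `Mp(W)` acts on `H(W)` by the `Sp(W)`-action
on `W`. The restriction `ω_{W,ψ} = ω_W` of `ρ_ψ` to `Mp(W)` is the Weil representation of `Mp(W)`. …
Then `ω_W` is realized on `L²(Y′) = L²(ℝ^N)`*"; (p. 47) "*Using the splittings constructed above, we
define … these yield homomorphisms `ι̃_{W,ξ} : G_V → Mp(𝕎)`, `ι̃_{V,ξ′} : G_W → Mp(𝕎)`. … Composing
the above homomorphisms with the Weil representation `ω_W` of `Mp(𝕎)`, we obtain the Weil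
representation `ω_{V,W,ξ} = ω_{W,ξ} × ω_{V,ξ′}` of `G_V × G_W`*"; (p. 49) "*`ξ(z) = (z/z̄)^{m/2}`,
`ξ′(z) = (z/z̄)^{m′/2}`, `m ≡ n′`, `m′ ≡ n (mod 2)`*"; (p. 73, Lemma 5.2) "*the restriction of
`(ω_{V,W,ξ}, P_{V,W,ξ})` to `K_V × K_W` is given by
`ω_{W,ξ}|_{G_{V⁺}} = det^{(m+q′−p′)/2} L(w_{j,k}) ⊗ R(w_{k,p′+j})`, …*" (four block formulae, module
docstring §1 of the imported file; `L`, `R` = substitution `P(w) ↦ P(g⁻¹.w.g′)` (§5.2 p. 72), fixing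
the constants [primes restored: pdftotext drops ′; placement fixed by KK07 §4.1 parity (m ≡ n′, m′ ≡ n)
and corroborated by Paul 1998 §1.2–1.3, JFA 159, pp. 389–390]) — so on the vacuum line `K_V × K_W`
acts by the four determinant powers alone.
Typed over the junction `D`: there is `ω : G_V × G_W → End 𝓢(ℝ^{DPIdx})`, Heisenberg-covariant over
`D.ι𝕎` (tree notion `IsPhaseCovariantS`; print: `Mp(𝕎)` acts on `H(𝕎)` through `Sp(𝕎)` and `ρ_ψ`
extends to `J(𝕎)`, composed with the homomorphisms `ι̃`), each `ω g` the restriction to `𝓢` of a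
unitary operator of `L²` (tree notion `LiftsTo`; print: "irreducible unitary representation",
"realized on `L²(Y′)`"), on whose vacuum `hermitePi 0` the maximal compact acts by `vacScalar e`.
This is the landed `FockVacuumCharacter D e` with the tree's continuity clause (w1) of
`IsArchWeilDatum` left out (module docstring: (w1) is derived in the tree, not printed).  The exponent
tuple `e` is a PARAMETER (the printed values are the separately named reading `kk07Reading`); the
instance's object-match duties are §4 (a)–(f) of the imported file's module docstring.
[cite: KonnoKonno2007, Lemma 5.2 (i)/(ii) p. 73 L44–102 with §5.2 p. 72 L7–10; §2.1 p. 38 L5–11, L38–39; §3.3 p. 47 L51–86; §4.1 p. 49 L21–28; cf. Thm 5.4 (i) (5.6)–(5.7) p. 75] -/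
def FockVacuumCharacterPrinted (D : RealDualPairJunction P Q R S Ginf) (e : VacExponents) : Prop :=
  ∃ ω : Representation ℂ Ginf (SchwartzMap (DPIdx P Q R S → ℝ) ℂ),
    IsPhaseCovariantS
        (fun g => ⇑((D.ι𝕎 g).1 :
          ((DPIdx P Q R S → ℝ) × (DPIdx P Q R S → ℝ)) ≃ₗ[ℝ]
            (DPIdx P Q R S → ℝ) × (DPIdx P Q R S → ℝ)))
        (fun g => ω g) ∧
      (∀ g, ∃ U : (Lp ℂ 2 (volume : Measure (DPIdx P Q R S → ℝ))) ≃ₗᵢ[ℂ]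
          Lp ℂ 2 (volume : Measure (DPIdx P Q R S → ℝ)),
        LiftsTo (ω g)
          ((U.toContinuousLinearEquiv : (Lp ℂ 2 (volume : Measure (DPIdx P Q R S → ℝ))) ≃L[ℂ]
              Lp ℂ 2 (volume : Measure (DPIdx P Q R S → ℝ))) :
            (Lp ℂ 2 (volume : Measure (DPIdx P Q R S → ℝ))) →L[ℂ]
              Lp ℂ 2 (volume : Measure (DPIdx P Q R S → ℝ)))) ∧
      ∀ k : DPK P Q R S, ω (D.κ k) (hermitePi 0) = vacScalar e k • hermitePi 0

/-! ## 2. Kernel: the two forms of the record -/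

variable {D : RealDualPairJunction P Q R S Ginf} {e : VacExponents}

/-- The landed record implies the printed-clauses-only one (drop (w1)). [folklore] -/
theorem FockVacuumCharacter.printed (h : D.FockVacuumCharacter e) : D.FockVacuumCharacterPrinted e :=
  let ⟨ω, hW, hvac⟩ := h
  ⟨ω, hW.covariant, hW.exists_lift, hvac⟩

/-- The printed record gives back the landed one along ANY upgrade map supplying the continuity clause
(w1) from the three printed clauses (covariance, unitary lifts, vacuum values) — at a concrete junction
this slot is the `KAK` descent (`JunctionContinuityKAK`). [folklore] -/
theorem FockVacuumCharacterPrinted.fockVacuumCharacter_of_continuous_upgrade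
    (h : D.FockVacuumCharacterPrinted e)
    (up : ∀ ω : Representation ℂ Ginf (SchwartzMap (DPIdx P Q R S → ℝ) ℂ),
      IsPhaseCovariantS
          (fun g => ⇑((D.ι𝕎 g).1 :
            ((DPIdx P Q R S → ℝ) × (DPIdx P Q R S → ℝ)) ≃ₗ[ℝ]
              (DPIdx P Q R S → ℝ) × (DPIdx P Q R S → ℝ)))
          (fun g => ω g) →
        (∀ g, ∃ U : (Lp ℂ 2 (volume : Measure (DPIdx P Q R S → ℝ))) ≃ₗᵢ[ℂ]
            Lp ℂ 2 (volume : Measure (DPIdx P Q R S → ℝ)),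
          LiftsTo (ω g)
            ((U.toContinuousLinearEquiv : (Lp ℂ 2 (volume : Measure (DPIdx P Q R S → ℝ))) ≃L[ℂ]
                Lp ℂ 2 (volume : Measure (DPIdx P Q R S → ℝ))) :
              (Lp ℂ 2 (volume : Measure (DPIdx P Q R S → ℝ))) →L[ℂ]
                Lp ℂ 2 (volume : Measure (DPIdx P Q R S → ℝ)))) →
        (∀ k : DPK P Q R S, ω (D.κ k) (hermitePi 0) = vacScalar e k • hermitePi 0) →
        ∀ f : SchwartzMap (DPIdx P Q R S → ℝ) ℂ, Continuous fun g => ω g f) :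
    D.FockVacuumCharacter e := by
  obtain ⟨ω, hcov, hlift, hvac⟩ := h
  exact ⟨ω, { continuous_apply := up ω hcov hlift hvac, covariant := hcov, exists_lift := hlift }, hvac⟩

/-- The printed record gives back the landed one along any upgrade map producing the full datum from the
three printed clauses — the curried shape in which the tree's junction theorems are stated
(`JunctionContinuityKAK.isArchWeilDatum_junction_of_vacScalar … ` / `…_of_compact_of_vacScalar … hV hW`
at `D :=` the concrete junction, partially applied to their `KAK` data). [folklore] -/
theorem FockVacuumCharacterPrinted.fockVacuumCharacter_of_upgrade (h : D.FockVacuumCharacterPrinted e)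
    (up : ∀ ω : Representation ℂ Ginf (SchwartzMap (DPIdx P Q R S → ℝ) ℂ),
      IsPhaseCovariantS
          (fun g => ⇑((D.ι𝕎 g).1 :
            ((DPIdx P Q R S → ℝ) × (DPIdx P Q R S → ℝ)) ≃ₗ[ℝ]
              (DPIdx P Q R S → ℝ) × (DPIdx P Q R S → ℝ)))
          (fun g => ω g) →
        (∀ g, ∃ U : (Lp ℂ 2 (volume : Measure (DPIdx P Q R S → ℝ))) ≃ₗᵢ[ℂ]
            Lp ℂ 2 (volume : Measure (DPIdx P Q R S → ℝ)),
          LiftsTo (ω g)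
            ((U.toContinuousLinearEquiv : (Lp ℂ 2 (volume : Measure (DPIdx P Q R S → ℝ))) ≃L[ℂ]
                Lp ℂ 2 (volume : Measure (DPIdx P Q R S → ℝ))) :
              (Lp ℂ 2 (volume : Measure (DPIdx P Q R S → ℝ))) →L[ℂ]
                Lp ℂ 2 (volume : Measure (DPIdx P Q R S → ℝ)))) →
        (∀ k : DPK P Q R S, ω (D.κ k) (hermitePi 0) = vacScalar e k • hermitePi 0) →
        IsArchWeilDatum D.ι𝕎 ω) :
    D.FockVacuumCharacter e := by
  obtain ⟨ω, hcov, hlift, hvac⟩ := h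
  exact ⟨ω, up ω hcov hlift hvac, hvac⟩

/-- Under such an upgrade map the two forms of the record are equivalent. [folklore] -/
theorem fockVacuumCharacter_iff_printed_of_upgrade
    (up : ∀ ω : Representation ℂ Ginf (SchwartzMap (DPIdx P Q R S → ℝ) ℂ),
      IsPhaseCovariantS
          (fun g => ⇑((D.ι𝕎 g).1 :
            ((DPIdx P Q R S → ℝ) × (DPIdx P Q R S → ℝ)) ≃ₗ[ℝ]
              (DPIdx P Q R S → ℝ) × (DPIdx P Q R S → ℝ)))
          (fun g => ω g) →
        (∀ g, ∃ U : (Lp ℂ 2 (volume : Measure (DPIdx P Q R S → ℝ))) ≃ₗᵢ[ℂ]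
            Lp ℂ 2 (volume : Measure (DPIdx P Q R S → ℝ)),
          LiftsTo (ω g)
            ((U.toContinuousLinearEquiv : (Lp ℂ 2 (volume : Measure (DPIdx P Q R S → ℝ))) ≃L[ℂ]
                Lp ℂ 2 (volume : Measure (DPIdx P Q R S → ℝ))) :
              (Lp ℂ 2 (volume : Measure (DPIdx P Q R S → ℝ))) →L[ℂ]
                Lp ℂ 2 (volume : Measure (DPIdx P Q R S → ℝ)))) →
        (∀ k : DPK P Q R S, ω (D.κ k) (hermitePi 0) = vacScalar e k • hermitePi 0) →
        IsArchWeilDatum D.ι𝕎 ω) :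
    D.FockVacuumCharacter e ↔ D.FockVacuumCharacterPrinted e :=
  ⟨FockVacuumCharacter.printed, fun h => h.fockVacuumCharacter_of_upgrade up⟩

/-! ## 3. Kernel: what the printed record yields without any continuity input -/

/-- From the printed record: a Heisenberg-covariant realisation over `ι_{V,W}` by restrictions of
unitaries exists at all (the splitting statement of §3.3, as the tree's rigidity lemmas consume it).
[folklore] -/
theorem FockVacuumCharacterPrinted.exists_covariant (h : D.FockVacuumCharacterPrinted e) :
    ∃ ω : Representation ℂ Ginf (SchwartzMap (DPIdx P Q R S → ℝ) ℂ),
      IsPhaseCovariantS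
          (fun g => ⇑((D.ι𝕎 g).1 :
            ((DPIdx P Q R S → ℝ) × (DPIdx P Q R S → ℝ)) ≃ₗ[ℝ]
              (DPIdx P Q R S → ℝ) × (DPIdx P Q R S → ℝ)))
          (fun g => ω g) ∧
        ∀ g, ∃ U : (Lp ℂ 2 (volume : Measure (DPIdx P Q R S → ℝ))) ≃ₗᵢ[ℂ]
            Lp ℂ 2 (volume : Measure (DPIdx P Q R S → ℝ)),
          LiftsTo (ω g)
            ((U.toContinuousLinearEquiv : (Lp ℂ 2 (volume : Measure (DPIdx P Q R S → ℝ))) ≃L[ℂ]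
                Lp ℂ 2 (volume : Measure (DPIdx P Q R S → ℝ))) :
              (Lp ℂ 2 (volume : Measure (DPIdx P Q R S → ℝ))) →L[ℂ]
                Lp ℂ 2 (volume : Measure (DPIdx P Q R S → ℝ))) :=
  let ⟨ω, hcov, hlift, _⟩ := h
  ⟨ω, hcov, hlift⟩

/-- **Value transfer to any other realisation over the same `ι_{V,W}`.**  If `ω` is an archimedean Weil
datum over `D.ι𝕎` (e.g. the cell's own `ω_∞`), the printed record forces its vacuum scalars on
`K_V × K_W` to be `vacScalar e` times a unitary character of `G_V × G_W` restricted along `κ` — by the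
tree's rigidity `IsArchWeilDatum.exists_character`, which consumes only covariance and unitary lifts of
the printed `ω′` (no continuity). [cite: Folland1989, §4.2, (4.23) and the Schur remark following it] -/
theorem FockVacuumCharacterPrinted.exists_circle_twist (h : D.FockVacuumCharacterPrinted e)
    {ω : Representation ℂ Ginf (SchwartzMap (DPIdx P Q R S → ℝ) ℂ)} (hW : IsArchWeilDatum D.ι𝕎 ω) :
    ∃ χ : Ginf →* Circle, ∀ k : DPK P Q R S,
      ω (D.κ k) (hermitePi 0) = (((χ (D.κ k) : Circle) : ℂ) * vacScalar e k) • hermitePi 0 := by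
  obtain ⟨ω', hcov', hlift', hvac'⟩ := h
  obtain ⟨χ, hχ⟩ := hW.exists_character hcov' hlift'
  refine ⟨χ⁻¹, fun k => ?_⟩
  have h1 : ((χ (D.κ k) : Circle) : ℂ) • ω (D.κ k) (hermitePi 0) = vacScalar e k • hermitePi 0 := by
    rw [← hχ, hvac']
  have hne : ((χ (D.κ k) : Circle) : ℂ) ≠ 0 := Circle.coe_ne_zero _
  rw [MonoidHom.inv_apply, Circle.coe_inv, ← smul_smul, ← h1, inv_smul_smul₀ hne]

/-- The same with both realisations Weil data (e.g. the landed record's `ω′` and the cell's `ω_∞`): the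
twisting character is moreover CONTINUOUS.
[cite: Folland1989, §4.2, (4.23) and the Schur remark following it] -/
theorem FockVacuumCharacter.exists_continuous_circle_twist (h : D.FockVacuumCharacter e)
    {ω : Representation ℂ Ginf (SchwartzMap (DPIdx P Q R S → ℝ) ℂ)} (hW : IsArchWeilDatum D.ι𝕎 ω) :
    ∃ χ : Ginf →* Circle, Continuous χ ∧ ∀ k : DPK P Q R S,
      ω (D.κ k) (hermitePi 0) = (((χ (D.κ k) : Circle) : ℂ) * vacScalar e k) • hermitePi 0 := by
  obtain ⟨ω', hW', hvac'⟩ := h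
  obtain ⟨χ, hχc, hχ⟩ := hW.exists_continuous_character hW'
  refine ⟨χ⁻¹, ?_, fun k => ?_⟩
  · show Continuous fun g => χ⁻¹ g
    simp only [MonoidHom.inv_apply]
    exact hχc.inv
  · have h1 : ((χ (D.κ k) : Circle) : ℂ) • ω (D.κ k) (hermitePi 0) = vacScalar e k • hermitePi 0 := by
      rw [← hχ, hvac']
    have hne : ((χ (D.κ k) : Circle) : ℂ) ≠ 0 := Circle.coe_ne_zero _
    rw [MonoidHom.inv_apply, Circle.coe_inv, ← smul_smul, ← h1, inv_smul_smul₀ hne]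

end RealDualPairJunction

end Literature.RepresentationTheory.KonnoKonno2007
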